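import Literature.NumberTheory.GaloisRepresentations.PrimeDegreeDifferent
import Literature.NumberTheory.GaloisRepresentations.KroneckerWeberProofs
import HarnessLib

/-!
# An abelian extension of degree `p²`, totally ramified over an absolutely unramified prime of residue characteristic `p`, is cyclic (Marcus, Ch. 4, Ex. 34)

The key step of the Hilbert–Speiser proof of the Kronecker–Weber theorem (Marcus, *Number Fields*,
Ch. 4, Ex. 34: "Now assume that `p` is odd and `m = 2` … Conclude that `G` is cyclic"), in the
global setting of the tree's ramification theory: `R` Dedekind with fraction field `K`, `L/K`
finite Galois with group `G = L ≃ₐ[K] L`, `S = integralClosure R L`, `𝔓 ≠ 0` a maximal ideal.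

* `emultiplicity_differentIdeal_eq_finsum_subgroup_add` (Ex. 34(d)): for `L/K` abelian, `𝔓`
  totally ramified with finite residue field of odd characteristic `p ∈ 𝔓`, `p ∉ 𝔭²`, and a
  subgroup `H ≤ G` of order and index `p`, `v_𝔓(𝔇_{S/R}) = Σ_{s ∈ H, s ≠ 1} i_G(s) + p·2(p-1)`
  (transitivity of the different along `R → S_{L^H} → S`, Hilbert's formula for `S/S_{L^H}`,
  `e(𝔓 | 𝔓 ∩ L^H) = p`, and `v(𝔇_{S_{L^H}/R}) = 2(p-1)` by `lowerIndex_eq_two_of_prime_degree`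
  applied to the Galois extension `L^H/K` of degree `p`).
* `isCyclic_of_card_eq_prime_sq` (Ex. 34): if moreover `[L : K] = p²` and the residue field of
  `𝔓` has `p` elements, then `G` is cyclic.  (`G = V₀ = V₁`; the first `V_{r+1} ≠ G` has order
  `p` as `#(V_r/V_{r+1}) ∣ p`, `= H₀` say, and `V_m = H₀` for `r < m ≤ s`, `V_{s+1} = 1`; were
  `G` not cyclic it would contain a second subgroup `H₁` of order `p` with `H₁ ∩ H₀ = 1`, and
  the previous display for `H₀` and `H₁` would give `(p-1)(s+1) = (p-1)(r+1)`, absurd.)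

For `K = ℚ` this says: an abelian number field of degree `p²` in which `p` is totally ramified is
cyclic; with Minkowski's theorem (`inertia_eq_top_of_isUnramifiedAt`,
`NumberFields/InertiaGeneratesGalois.lean`) it yields Marcus's Ex. 35–36 (the only abelian
extensions of `ℚ` of `p`-power degree unramified outside `p` are the layers of the cyclotomic
`ℤ_p`-extension), the heart of the odd part of Kronecker–Weber.

## References

* D. A. Marcus, *Number Fields*, 2nd ed., Universitext, Springer (2018), Ch. 4, Ex. 34
  (pp. 102–103). [Marcus2018]
* J.-P. Serre, *Local Fields*, GTM 67 (1979), Ch. III §4 Prop. 8, Ch. IV §1 Prop. 4.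
  [SerreLocalFields1979]
-/

open Polynomial
open scoped Pointwise IsMulCommutative

noncomputable section

namespace Literature.NumberTheory.GaloisRepresentations

variable (R : Type*) {K L : Type*} [CommRing R] [IsDedekindDomain R] [Field K] [Field L]
  [Algebra R K] [IsFractionRing R K] [Algebra R L] [Algebra K L] [IsScalarTower R K L]
  [FiniteDimensional K L] [IsGalois K L]

/-- **The different along the fixed field of a subgroup of order `p`** (Marcus, Ch. 4, Ex. 34(d)).
In the setting of `lowerIndex_eq_two_of_prime_degree` — `L/K` abelian, `𝔓` totally ramified
with finite residue field of characteristic `p ∈ 𝔓`, `p` odd, `p ∉ 𝔭²` — let `H ≤ G` be a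
subgroup of order `p` and index `p`, with fixed field `F = L^H`.  Then
`v_𝔓(𝔇_{S/R}) = Σ_{s ∈ H, s ≠ 1} i_G(s) + p · 2(p-1)`: transitivity of the different along
`R → S_F → S` at `𝔓` (`emultiplicity_differentIdeal_eq_add`), Hilbert's formula for `S/S_F`
(`emultiplicity_differentIdeal_eq_finsum_lowerIndex`), `e(𝔓 | 𝔓_F) = |H| = p`, and
`v_{𝔓_F}(𝔇_{S_F/R}) = 2(p-1)` (`lowerIndex_eq_two_of_prime_degree` for the Galois extension
`F/K` of degree `p`, totally ramified at `𝔓_F`).  Marcus: "`diff(R|ℤ) = diff(R|R_H) P^{2(p-1)p}`".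
[cite: Marcus2018, Ch. 4, Ex. 34(d) (p. 102)] -/
theorem emultiplicity_differentIdeal_eq_finsum_subgroup_add
    [IsDedekindDomain (integralClosure R L)] [Module.IsTorsionFree R (integralClosure R L)]
    [IsMulCommutative (L ≃ₐ[K] L)]
    (𝔓 : Ideal (integralClosure R L)) [𝔓.IsMaximal] (h𝔓 : 𝔓 ≠ ⊥)
    [Finite (integralClosure R L ⧸ 𝔓)]
    {p : ℕ} (hp : p.Prime) (hp2 : p ≠ 2)
    (htot : 𝔓.inertia (L ≃ₐ[K] L) = ⊤)
    (hpP : (p : integralClosure R L) ∈ 𝔓) (hp𝔭 : (p : R) ∉ (𝔓.under R) ^ 2)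
    (H : Subgroup (L ≃ₐ[K] L)) (hH : Nat.card H = p) (hHi : H.index = p) :
    emultiplicity 𝔓 (differentIdeal R (integralClosure R L)) =
      (∑ᶠ (s : L ≃ₐ[K] L) (_ : s ∈ H ∧ s ≠ 1), lowerIndex 𝔓 (L ≃ₐ[K] L) s) +
        ((p * (2 * (p - 1)) : ℕ) : ℕ∞) := by
  classical
  haveI h𝔓prime : 𝔓.IsPrime := Ideal.IsMaximal.isPrime inferInstance
  haveI : FaithfulSMul (L ≃ₐ[K] L) (integralClosure R L) := faithfulSMul_algEquiv_integralClosure R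
  haveI : IsFractionRing (integralClosure R L) L :=
    integralClosure.isFractionRing_of_finite_extension K L
  haveI : (𝔓.under R).IsMaximal := Ideal.IsMaximal.under R 𝔓
  haveI : Algebra.IsSeparable (R ⧸ 𝔓.under R) (integralClosure R L ⧸ 𝔓) :=
    isSeparable_residue_of_finite 𝔓
  -- the fixed field `F = L^H`, Galois over `K` of degree `p`, and the tower `R → S_F → S_L`
  set F : IntermediateField K L := IntermediateField.fixedField H with hF
  have hΓ : F.fixingSubgroup = H := IntermediateField.fixingSubgroup_fixedField H
  haveI : H.Normal := inferInstance
  haveI : IsGalois K F := IsGalois.of_fixedField_normal_subgroup H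
  letI := integralClosureAlgebra R F (L := L)
  haveI := integralClosure_isScalarTower_left R F (L := L)
  haveI := integralClosure_isScalarTower_bot R F (L := L)
  haveI := integralClosure_faithfulSMul R F (L := L)
  haveI := integralClosure_isIntegral R F (L := L)
  haveI := integralClosure_isTorsionFree R F (K := K) (L := L)
  haveI := isMaximal_under_integralClosure R F 𝔓 (K := K) (L := L)
  haveI := under_integralClosure_liesOver R F 𝔓 (K := K) (L := L)
  haveI := integralClosure_moduleFinite R F (K := K) (L := L)
  haveI : IsFractionRing (integralClosure R F) F :=
    integralClosure.isFractionRing_of_finite_extension K F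
  haveI : IsDedekindDomain (integralClosure R F) := integralClosure.isDedekindDomain R K F
  haveI : Module.Finite R (integralClosure R F) :=
    IsIntegralClosure.finite R K F (integralClosure R F)
  haveI : Module.Finite R (integralClosure R L) :=
    IsIntegralClosure.finite R K L (integralClosure R L)
  haveI hfR : FaithfulSMul R (integralClosure R F) := faithfulSMul_integralClosure R (K := K) (L := F)
  haveI : Module.IsTorsionFree R (integralClosure R F) := by
    rw [Module.isTorsionFree_iff_faithfulSMul]; infer_instance
  -- separability of `Frac(S_L)/Frac(R)`, transported from `L/K`
  letI aS : Algebra (integralClosure R L) (FractionRing (integralClosure R L)) :=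
    OreLocalization.instAlgebra
  letI sS : SMul (integralClosure R L) (FractionRing (integralClosure R L)) := aS.toSMul
  letI a₁ : Algebra R (FractionRing (integralClosure R L)) := OreLocalization.instAlgebra
  letI s₁ : SMul R (FractionRing (integralClosure R L)) := a₁.toSMul
  haveI : IsScalarTower R (integralClosure R L) (FractionRing (integralClosure R L)) :=
    IsScalarTower.of_algebraMap_eq fun _ => rfl
  haveI : FaithfulSMul R (FractionRing (integralClosure R L)) := by
    haveI : FaithfulSMul R (integralClosure R L) := faithfulSMul_integralClosure R (K := K) (L := L)
    exact FaithfulSMul.trans R (integralClosure R L) _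
  letI a₁₁ : Algebra R (FractionRing R) := OreLocalization.instAlgebra
  letI s₁₁ : SMul R (FractionRing R) := a₁₁.toSMul
  letI aFF : Algebra (FractionRing R) (FractionRing (integralClosure R L)) :=
    FractionRing.liftAlgebra _ _
  letI sFF : SMul (FractionRing R) (FractionRing (integralClosure R L)) := aFF.toSMul
  haveI : IsScalarTower R (FractionRing R) (FractionRing (integralClosure R L)) :=
    FractionRing.isScalarTower_liftAlgebra _ _
  haveI : Algebra.IsSeparable (FractionRing R) (FractionRing (integralClosure R L)) := by
    refine Algebra.IsSeparable.of_equiv_equiv (FractionRing.algEquiv R K).symm.toRingEquiv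
      (FractionRing.algEquiv (integralClosure R L) L).symm.toRingEquiv ?_
    ext _
    exact IsFractionRing.algEquiv_commutes (FractionRing.algEquiv R K).symm
      (FractionRing.algEquiv (integralClosure R L) L).symm _
  -- transitivity of the different along `R → S_F → S_L` at `𝔓`
  have HT := emultiplicity_differentIdeal_eq_add (A := R) (B := integralClosure R F)
    (C := integralClosure R L) 𝔓 h𝔓
  -- Hilbert's formula for `S_L/S_F`
  have hD : F.fixingSubgroup ≤ 𝔓.decompositionSubgroup (L ≃ₐ[K] L) := fun g _ =>
    𝔓.inertia_le_stabilizer (htot ▸ Subgroup.mem_top g)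
  have hHilbF := emultiplicity_differentIdeal_eq_finsum_lowerIndex R F 𝔓 h𝔓 hD
  -- `e(𝔓 | 𝔓_F) = |H| = p`
  have he : (𝔓.under (integralClosure R F)).ramificationIdx' 𝔓 = p := by
    rw [ramificationIdx'_under_eq_card_inertia R F 𝔓 h𝔓]
    have htop : 𝔓.inertia F.fixingSubgroup = ⊤ := by
      rw [eq_top_iff]
      intro g _ x
      exact (show (g : L ≃ₐ[K] L) ∈ 𝔓.inertia (L ≃ₐ[K] L) from htot ▸ Subgroup.mem_top _) x
    rw [htop, Subgroup.card_top, hΓ, hH]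
  -- the hypotheses of Ex. 33 for `F/K` at `𝔓_F`
  have hpF : 𝔓.under (integralClosure R F) ≠ ⊥ := Ideal.IsIntegral.comap_ne_bot _ h𝔓
  haveI : Finite (integralClosure R F ⧸ 𝔓.under (integralClosure R F)) :=
    Finite.of_injective _ Ideal.algebraMap_quotient_injective
  have hcardF : Nat.card (F ≃ₐ[K] F) = p := by
    rw [IsGalois.card_aut_eq_finrank, hF, finrank_fixedField_eq_card_quotient, ← Subgroup.index,
      hHi]
  have htotF : (𝔓.under (integralClosure R F)).inertia (F ≃ₐ[K] F) = ⊤ := by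
    have h1 := map_inertia_restrictNormalHom R F 𝔓
    rw [htot, Subgroup.map_top_of_surjective _ (AlgEquiv.restrictNormalHom_surjective L)] at h1
    have h2 : 𝔓.comap (F.integralClosureInclusion R) = 𝔓.under (integralClosure R F) :=
      Ideal.ext fun _ => Iff.rfl
    rw [← h2, ← h1]
  have hpPF : (p : integralClosure R F) ∈ 𝔓.under (integralClosure R F) := by
    rw [Ideal.under_def, Ideal.mem_comap, map_natCast]; exact hpP
  have hp𝔭F : (p : R) ∉ ((𝔓.under (integralClosure R F)).under R) ^ 2 := by
    rw [Ideal.under_under]; exact hp𝔭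
  have hF7 := (lowerIndex_eq_two_of_prime_degree R (𝔓.under (integralClosure R F)) hpF hp hp2
    hcardF htotF hpPF hp𝔭F).2
  -- assemble
  have hfs : (∑ᶠ (s : L ≃ₐ[K] L) (_ : s ∈ F.fixingSubgroup ∧ s ≠ 1), lowerIndex 𝔓 (L ≃ₐ[K] L) s) =
      ∑ᶠ (s : L ≃ₐ[K] L) (_ : s ∈ H ∧ s ≠ 1), lowerIndex 𝔓 (L ≃ₐ[K] L) s := by
    simp_rw [hΓ]
  have hcast : ((p : ℕ) : ℕ∞) * (((2 * (p - 1) : ℕ)) : ℕ∞) = ((p * (2 * (p - 1)) : ℕ) : ℕ∞) := by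
    norm_cast
  rw [HT, hHilbF, he, hF7, hfs, hcast]

/-- **Marcus, *Number Fields*, Ch. 4, Ex. 34: an abelian extension of degree `p²`, totally
ramified over an absolutely unramified prime of residue characteristic `p` (odd), is cyclic.**
Let `R` be Dedekind with fraction field `K`, `L/K` abelian of degree `p²` (`p` an odd prime),
`S = integralClosure R L`, `𝔓 ≠ 0` a maximal ideal of `S` which is totally ramified (`T_𝔓 = G`)
with residue field of order `p` (so of characteristic `p ∈ 𝔓`), and `p ∉ 𝔭²`, `𝔭 = 𝔓 ∩ R`
(e.g. `K = ℚ`, `L` abelian of degree `p²` in which `p` is totally ramified).  Then `G = Gal(L/K)`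
is cyclic.  Proof (Marcus (a)–(e)): `G = V₀ = V₁`; let `V_{r+1}` be the first ramification group
`≠ G`; as `#(V_r/V_{r+1}) ≤ p` it has order `p`, `= H₀` say, and `V_m = H₀` for `r < m ≤ s`,
`V_{s+1} = 1`.  If `G` were not cyclic it would have a second subgroup `H₁` of order `p`,
`H₁ ∩ H₀ = 1`.  By `emultiplicity_differentIdeal_eq_finsum_subgroup_add` for `H₀` and `H₁`,
`Σ_{s ∈ H₀, s ≠ 1} i_G(s) = Σ_{s ∈ H₁, s ≠ 1} i_G(s)`, i.e. `(p-1)(s+1) = (p-1)(r+1)` — absurd.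
[cite: Marcus2018, Ch. 4, Ex. 34 (pp. 102–103)] -/
theorem isCyclic_of_card_eq_prime_sq
    [IsDedekindDomain (integralClosure R L)] [Module.IsTorsionFree R (integralClosure R L)]
    [IsMulCommutative (L ≃ₐ[K] L)]
    (𝔓 : Ideal (integralClosure R L)) [𝔓.IsMaximal] (h𝔓 : 𝔓 ≠ ⊥)
    [Finite (integralClosure R L ⧸ 𝔓)]
    {p : ℕ} (hp : p.Prime) (hp2 : p ≠ 2) (hcard : Nat.card (L ≃ₐ[K] L) = p ^ 2)
    (hres : Nat.card (integralClosure R L ⧸ 𝔓) = p)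
    (htot : 𝔓.inertia (L ≃ₐ[K] L) = ⊤)
    (hpP : (p : integralClosure R L) ∈ 𝔓) (hp𝔭 : (p : R) ∉ (𝔓.under R) ^ 2) :
    IsCyclic (L ≃ₐ[K] L) := by
  classical
  by_contra hnc
  haveI : Fintype (L ≃ₐ[K] L) := Fintype.ofFinite _
  haveI h𝔓prime : 𝔓.IsPrime := Ideal.IsMaximal.isPrime inferInstance
  haveI : FaithfulSMul (L ≃ₐ[K] L) (integralClosure R L) := faithfulSMul_algEquiv_integralClosure R
  letI : Field (integralClosure R L ⧸ 𝔓) := Ideal.Quotient.field 𝔓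
  have hstab : ∀ g : L ≃ₐ[K] L, g • 𝔓 = 𝔓 := smul_eq_of_inertia_eq_top htot
  have hV0 : 𝔓.ramificationSubgroup (L ≃ₐ[K] L) 0 = ⊤ := ramificationSubgroup_zero_eq_top R 𝔓 htot
  -- residue characteristic `p`
  have hchar : ringChar (integralClosure R L ⧸ 𝔓) = p := by
    have h1 : ringChar (integralClosure R L ⧸ 𝔓) ∣ p := by
      refine ringChar.dvd ?_
      rw [← map_natCast (Ideal.Quotient.mk 𝔓), Ideal.Quotient.eq_zero_iff_mem]
      exact hpP
    rcases (Nat.dvd_prime hp).mp h1 with h | h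
    · exact absurd h CharP.ringChar_ne_one
    · exact h
  -- (b) `V₁ = G`
  have hV1 : 𝔓.ramificationSubgroup (L ≃ₐ[K] L) 1 = ⊤ := by
    have hcop := relIndex_ramificationSubgroup_one_coprime_ringChar (G := L ≃ₐ[K] L) h𝔓
    rw [hV0, Subgroup.relIndex_top_right, hchar] at hcop
    have hdvd : (𝔓.ramificationSubgroup (L ≃ₐ[K] L) 1).index ∣ p ^ 2 :=
      hcard ▸ Subgroup.index_dvd_card _
    exact Subgroup.index_eq_one.mp
      (Nat.Coprime.eq_one_of_dvd (Nat.Coprime.pow_right 2 hcop) hdvd)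
  -- (c) the first ramification group `V_{r+1} ≠ G` has order `p`
  obtain ⟨N, hN⟩ := Ideal.ramificationSubgroup_eventually_eq_bot_holds 𝔓 (L ≃ₐ[K] L)
    (Ideal.IsMaximal.ne_top inferInstance)
  have hGne : (⊤ : Subgroup (L ≃ₐ[K] L)) ≠ ⊥ := by
    intro h
    have h1 := Subgroup.card_top (G := L ≃ₐ[K] L)
    rw [h, Subgroup.card_bot, hcard] at h1
    exact (Nat.one_lt_pow two_ne_zero hp.one_lt).ne h1
  have hex1 : ∃ n, 𝔓.ramificationSubgroup (L ≃ₐ[K] L) n ≠ ⊤ := ⟨N, by rw [hN N le_rfl]; exact hGne.symm⟩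
  have hn₁2 : 2 ≤ Nat.find hex1 := by
    by_contra hlt
    have hne := Nat.find_spec hex1
    rcases Nat.le_one_iff_eq_zero_or_eq_one.mp (by omega : Nat.find hex1 ≤ 1) with h | h
    · rw [h] at hne; exact hne hV0
    · rw [h] at hne; exact hne hV1
  set r := Nat.find hex1 - 1 with hr
  have hr1 : 1 ≤ r := by omega
  have hVr : 𝔓.ramificationSubgroup (L ≃ₐ[K] L) r = ⊤ := by
    have := Nat.find_min hex1 (show r < Nat.find hex1 by omega)
    simpa using this
  set H₀ := 𝔓.ramificationSubgroup (L ≃ₐ[K] L) (r + 1) with hH₀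
  have hH₀ne : H₀ ≠ ⊤ := by
    have := Nat.find_spec hex1
    rwa [show Nat.find hex1 = r + 1 by omega] at this
  have hH₀i : H₀.index = p := by
    have hdvd : H₀.relIndex (𝔓.ramificationSubgroup (L ≃ₐ[K] L) r) ∣ Nat.card (integralClosure R L ⧸ 𝔓) :=
      relIndex_ramificationSubgroup_succ_dvd (G := L ≃ₐ[K] L) h𝔓 hr1
    rw [hVr, Subgroup.relIndex_top_right, hres, Nat.dvd_prime hp] at hdvd
    rcases hdvd with h | h
    · exact absurd (Subgroup.index_eq_one.mp h) hH₀ne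
    · exact h
  have hH₀c : Nat.card H₀ = p := by
    have h1 := H₀.card_mul_index
    rw [hH₀i, hcard, pow_two] at h1
    exact Nat.eq_of_mul_eq_mul_right hp.pos h1
  -- (c') the last nontrivial ramification group is `H₀`: `V_m = H₀` for `r < m ≤ s`, `V_{s+1} = 1`
  have hex2 : ∃ n, 𝔓.ramificationSubgroup (L ≃ₐ[K] L) n = ⊥ := ⟨N, hN N le_rfl⟩
  have hH₀nb : H₀ ≠ ⊥ := by
    intro h; rw [h, Subgroup.card_bot] at hH₀c; exact hp.one_lt.ne hH₀c
  have hn₂ : r + 2 ≤ Nat.find hex2 := by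
    by_contra hlt
    have hbot := Nat.find_spec hex2
    have hle : H₀ ≤ 𝔓.ramificationSubgroup (L ≃ₐ[K] L) (Nat.find hex2) :=
      𝔓.ramificationSubgroup_antitone (L ≃ₐ[K] L) (by omega)
    rw [hbot, le_bot_iff] at hle
    exact hH₀nb hle
  set s := Nat.find hex2 - 1 with hs
  have hsr : r + 1 ≤ s := by omega
  have hVs1 : 𝔓.ramificationSubgroup (L ≃ₐ[K] L) (s + 1) = ⊥ := by
    rw [show s + 1 = Nat.find hex2 by omega]; exact Nat.find_spec hex2
  have hVs : 𝔓.ramificationSubgroup (L ≃ₐ[K] L) s = H₀ := by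
    have hne : 𝔓.ramificationSubgroup (L ≃ₐ[K] L) s ≠ ⊥ := Nat.find_min hex2 (by omega)
    have hle : 𝔓.ramificationSubgroup (L ≃ₐ[K] L) s ≤ H₀ :=
      𝔓.ramificationSubgroup_antitone (L ≃ₐ[K] L) hsr
    -- a nontrivial subgroup of the group `H₀` of prime order is all of it
    have hdvd := Subgroup.card_dvd_of_le hle
    rw [hH₀c, Nat.dvd_prime hp] at hdvd
    rcases hdvd with h | h
    · exact absurd (Subgroup.card_eq_one.mp h) hne
    · exact Subgroup.eq_of_le_of_card_ge hle (by rw [h, hH₀c])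
  -- the values of `i_G`
  have hi_out : ∀ g : L ≃ₐ[K] L, g ∉ H₀ → lowerIndex 𝔓 (L ≃ₐ[K] L) g = ((r + 1 : ℕ) : ℕ∞) := by
    intro g hg
    apply le_antisymm
    · rw [lowerIndex_le_natCast_iff]; exact hg
    · have := add_one_le_lowerIndex 𝔓
        (show g ∈ 𝔓.ramificationSubgroup (L ≃ₐ[K] L) r from hVr ▸ Subgroup.mem_top g)
      exact_mod_cast this
  have hi_in : ∀ g : L ≃ₐ[K] L, g ∈ H₀ → g ≠ 1 → lowerIndex 𝔓 (L ≃ₐ[K] L) g = ((s + 1 : ℕ) : ℕ∞) := by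
    intro g hg hg1
    apply le_antisymm
    · rw [lowerIndex_le_natCast_iff, hVs1]; exact fun h => hg1 (Subgroup.mem_bot.mp h)
    · have := add_one_le_lowerIndex 𝔓
        (show g ∈ 𝔓.ramificationSubgroup (L ≃ₐ[K] L) s from hVs.symm ▸ hg)
      exact_mod_cast this
  -- (e) a second subgroup `H₁` of order `p`, meeting `H₀` trivially (as `G` is not cyclic)
  obtain ⟨g, hg⟩ : ∃ g : L ≃ₐ[K] L, g ∉ H₀ := by
    by_contra h; push Not at h
    exact hH₀ne (eq_top_iff.mpr fun g _ => h g)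
  have hg1 : g ≠ 1 := fun h => hg (h ▸ H₀.one_mem)
  have hgord : orderOf g = p := by
    have hdvd : orderOf g ∣ p ^ 2 := hcard ▸ orderOf_dvd_natCard g
    rcases (Nat.dvd_prime_pow hp).mp hdvd with ⟨k, hk, hk'⟩
    interval_cases k
    · rw [pow_zero] at hk'; exact absurd (orderOf_eq_one_iff.mp hk') hg1
    · rw [pow_one] at hk'; exact hk'
    · exfalso; apply hnc
      exact isCyclic_of_orderOf_eq_card g (by rw [hk', ← hcard])
  set H₁ : Subgroup (L ≃ₐ[K] L) := Subgroup.zpowers g with hH₁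
  have hH₁c : Nat.card H₁ = p := by rw [hH₁, Nat.card_zpowers, hgord]
  have hH₁i : H₁.index = p := by
    have h1 := H₁.card_mul_index
    rw [hH₁c, hcard, pow_two] at h1
    exact Nat.eq_of_mul_eq_mul_left hp.pos h1
  have hmeet : ∀ h : L ≃ₐ[K] L, h ∈ H₁ → h ≠ 1 → h ∉ H₀ := by
    intro h hh hh1 hh0
    -- `H₁ ∩ H₀` is a nontrivial subgroup of `H₁`, hence all of `H₁`, so `g ∈ H₀`
    have hle : H₁ ⊓ H₀ ≤ H₁ := inf_le_left
    have hdvd := Subgroup.card_dvd_of_le hle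
    rw [hH₁c, Nat.dvd_prime hp] at hdvd
    rcases hdvd with h1 | h1
    · have : h ∈ H₁ ⊓ H₀ := ⟨hh, hh0⟩
      rw [Subgroup.card_eq_one.mp h1] at this
      exact hh1 (Subgroup.mem_bot.mp this)
    · have heq : H₁ ⊓ H₀ = H₁ := Subgroup.eq_of_le_of_card_ge hle (by rw [h1, hH₁c])
      have : g ∈ H₁ ⊓ H₀ := by rw [heq]; exact Subgroup.mem_zpowers g
      exact hg this.2
  -- the two sums `Σ_{s ∈ H, s ≠ 1} i_G(s)`
  have hsum₀ : ∑ᶠ (x : L ≃ₐ[K] L) (_ : x ∈ H₀ ∧ x ≠ 1), lowerIndex 𝔓 (L ≃ₐ[K] L) x =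
      (((p - 1) * (s + 1) : ℕ) : ℕ∞) := by
    rw [finsum_cond_eq_sum_of_cond_iff (t := (Finset.univ.filter fun x => x ∈ H₀).erase 1) _
        (fun {x} _ => by simp [and_comm]),
      Finset.sum_congr rfl fun x hx => hi_in x (Finset.mem_filter.mp (Finset.mem_of_mem_erase hx)).2
        (Finset.ne_of_mem_erase hx),
      Finset.sum_const, Finset.card_erase_of_mem (by simp [H₀.one_mem]), nsmul_eq_mul]
    have : (Finset.univ.filter fun x : L ≃ₐ[K] L => x ∈ H₀).card = p := by
      rw [← hH₀c, Nat.card_eq_fintype_card, ← Fintype.card_subtype]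
    rw [this]
    norm_cast
  have hsum₁ : ∑ᶠ (x : L ≃ₐ[K] L) (_ : x ∈ H₁ ∧ x ≠ 1), lowerIndex 𝔓 (L ≃ₐ[K] L) x =
      (((p - 1) * (r + 1) : ℕ) : ℕ∞) := by
    rw [finsum_cond_eq_sum_of_cond_iff (t := (Finset.univ.filter fun x => x ∈ H₁).erase 1) _
        (fun {x} _ => by simp [and_comm]),
      Finset.sum_congr rfl fun x hx => hi_out x (hmeet x
        (Finset.mem_filter.mp (Finset.mem_of_mem_erase hx)).2 (Finset.ne_of_mem_erase hx)),
      Finset.sum_const, Finset.card_erase_of_mem (by simp [H₁.one_mem]), nsmul_eq_mul]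
    have : (Finset.univ.filter fun x : L ≃ₐ[K] L => x ∈ H₁).card = p := by
      rw [← hH₁c, Nat.card_eq_fintype_card, ← Fintype.card_subtype]
    rw [this]
    norm_cast
  -- (d) the different computed along `L^{H₀}` and along `L^{H₁}`
  have h₀ := emultiplicity_differentIdeal_eq_finsum_subgroup_add R 𝔓 h𝔓 hp hp2 htot hpP hp𝔭
    H₀ hH₀c hH₀i
  have h₁ := emultiplicity_differentIdeal_eq_finsum_subgroup_add R 𝔓 h𝔓 hp hp2 htot hpP hp𝔭
    H₁ hH₁c hH₁i
  rw [hsum₀] at h₀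
  rw [hsum₁, h₀] at h₁
  have h2 : (p - 1) * (s + 1) + p * (2 * (p - 1)) = (p - 1) * (r + 1) + p * (2 * (p - 1)) := by
    exact_mod_cast h₁
  have h3 : (p - 1) * (s + 1) = (p - 1) * (r + 1) := by omega
  have h4 := Nat.eq_of_mul_eq_mul_left (by have := hp.two_le; omega) h3
  omega

end Literature.NumberTheory.GaloisRepresentations
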